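import Summits.AtomisticToContinuum.HydrodynamicLimit.Theorems.BoxDissipativeWeakStrongEntropyAdmissibilityDynamicCore
import Summits.AtomisticToContinuum.HydrodynamicLimit.Theorems.BoxDissipativeWeakStrongRelativeEnergyStabilityGronwallPathwiseB
import HarnessLib

/-!
# Crux `EntropyAdmissibility` (stmt-AtomisticToContinuum-9903), line `mean_via_weak_strong` — stub `stub_meanEntropyForcing` (C3b)

Registered stub C3b of the line `mean_via_weak_strong` of the crux
`Summit.AtomisticToContinuum.HydrodynamicLimit.Theses.BoxDissipativeWeakStrong.EntropyAdmissibility`: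
**the MEAN entropy forcing from S1b.**  S1b (`Sig.stub_meanEntropyDeficit`, the open heart of the line, taken here as a
HYPOTHESIS) says, in the crux's quantifier frame: for every `ε > 0`, eventually in `N`, `E_{P_N}[A_N] + B ≤ ε`, where
`A_N = BDWS.dynPart` is the dynamic part of the clamp-renormalised entropy balance and `B = BDWS.initLimit` the clamped cut
entropy of the Euler data.  The signed relative-energy Grönwall of the line (stub C3c) consumes instead, in the vocabulary
of `RES.sx_entropyAdmissibility_temperature` (K2 tested with the strong temperature `φ := θ`, written over `RES.boxState` /
`RES.cutEOS`), the two facts: for every `N` the SIGNED functional `K2f_N(τ) = A_N + B_N` (`B_N = BDWS.initPart`) is in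
`L¹(P_N)`, and for every `ε > 0` eventually `∫ K2f_N(τ) dP_N ≤ ε`.

Proof.  (1) In the frame (`EABirthCore.InFrame.mono₃`, thresholds `η₀` of the EOS fact and `σ < 1/2` so that `P_N` is a
probability measure) combine the landed S1a `EABirthCore.inFrame_int` (`A_N ∈ L¹`), the landed statics S0
`EABirthCore.inFrame_stat` (`E|B_N − B| → 0`) and S1b: `B_N ∈ L¹` by `EABirthS1bNec.integrable_initPart`, and
`∫ (A_N + B_N) = (∫ A_N + B) + ∫ (B_N − B) ≤ (∫ A_N + B) + E|B_N − B| ≤ ε/2 + ε/2` eventually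
(`eventually_integral_add_le`).  (2) Instantiate at `φ := θ` (`θ` smooth and positive on `[0,T)` for a classical
solution); the RES integrand is DEFINITIONALLY `dynPart σ η₁ T ℓ Φ τ a b θ N z + initPart σ η₁ ℓ Φ a b θ N z`.

References: J. Březina, E. Feireisl, J. Math. Soc. Japan 70 (2018) §3.2; H. Spohn, *Large Scale Dynamics of Interacting
Particles* (1991), Part I §3.3.  prover-line-stmt-AtomisticToContinuum-9903-c3-0 (worker C3b).
-/

noncomputable section

open MeasureTheory Filter Set
open scoped ENNReal Topology InnerProductSpace BigOperators

namespace Summit.AtomisticToContinuum.HydrodynamicLimit.Theorems.EAMeanWSb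

open Literature.MathematicalPhysics.KineticTheory
open Summit.AtomisticToContinuum.HydrodynamicLimit.Theses
open Summit.AtomisticToContinuum.HydrodynamicLimit.Theorems.EABirthCore (Conclusion InFrame Cdef Cstat Cint)

/-! ## §1 Stub signatures (verbatim the lead's skeleton) -/

section BDWSVocabulary

open Summit.AtomisticToContinuum.HydrodynamicLimit.Theorems.BDWS

/-- **S1b — the annealed local entropy DEFICIT bound (THE HEART, open; shared verbatim with `Lines/birth.lean`).** In the crux's
frame: for every `ε > 0`, eventually in `N`, `E_{P_N}[A_N] + B ≤ ε`.  Necessary for the crux (`EABirthCore`), and — by this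
line — sufficient for it together with `FluxClosure`.  Sources: BrezinaFeireisl2018 Def. 2.9/§3.2, Spohn1991 §3.3,
OllaVaradhanYau1993, KipnisLandim1999 Ch. 6. -/
def Sig.stub_meanEntropyDeficit : Prop :=
  BoxDissipativeWeakStrong.HsEosLowDensity →
    ∃ ηc : ℝ, 0 < ηc ∧ ∀ η₁ : ℝ, 0 < η₁ → η₁ < ηc →
      ∀ (a₀ θ₀ : T3 → ℝ) (u₀ : T3 → V3), Continuous a₀ → Continuous θ₀ → Continuous u₀ →
        (∀ x, 0 < a₀ x) → (∀ x, 0 < θ₀ x) →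
        ∃ σ₀ : ℝ, 0 < σ₀ ∧ ∀ σ : ℝ, 0 < σ → σ < σ₀ →
          ∀ (T : ℝ) (ρ θ : ℝ → T3 → ℝ) (u : ℝ → T3 → V3), IsHardSphereEulerSolution σ T ρ u θ →
            (∀ t ∈ Ico 0 T, ∀ x, ρ t x * σ ^ 3 ≤ η₁ / 2) →
            ∀ Φ : FlowFamily σ,
              TendstoHydroFieldsAt (fun N => localGibbsLaw σ a₀ u₀ θ₀ N (Φ N)) Φ ρ u θ 0 →
              ∀ ℓ : ℕ → ℝ, (∀ N, 0 < ℓ N ∧ ℓ N ≤ 1) → Tendsto ℓ atTop (𝓝 0) →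
                Tendsto (fun N : ℕ => ℓ N ^ 3 * ((N : ℝ) + 1)) atTop atTop →
                ∀ τ ∈ Ico 0 T, ∀ a b : ℝ, a < b → ∀ φ : ℝ → T3 → ℝ,
                  Literature.Analysis.FunctionSpaces.Torus.IsSmoothSpaceTimeOn (Ico 0 T) φ →
                  (∀ t ∈ Icc 0 τ, ∀ x, 0 ≤ φ t x) →
                  ∀ ε : ℝ, 0 < ε → ∀ᶠ N : ℕ in atTop,
                    (∫ z, dynPart σ η₁ T ℓ Φ τ a b φ N z ∂(localGibbsLaw σ a₀ u₀ θ₀ N (Φ N))) +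
                        initLimit σ η₁ ρ θ a b φ ≤ ε

end BDWSVocabulary

section RESVocabulary

open Summit.AtomisticToContinuum.HydrodynamicLimit.Theorems.RES
open Literature.Analysis.FluidPDE Literature.Analysis.FunctionSpaces
open Literature.Analysis.FluidPDE.CompressibleEuler
open Literature.Analysis.FluidPDE.CompressibleEuler.EulerPhase
open Literature.Analysis.FluidPDE.CompressibleEuler.StrongPointData

/-- **C3b — the MEAN entropy forcing from S1b (size M).** `S1b →` (EOS fact `→`) in the frame of
`RES.sx_entropyAdmissibility_temperature` (K2 tested with the strong temperature `φ := θ` and the clamp `Z_{a,b}`, written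
over `RES.boxState` / `RES.cutEOS` — definitionally `BDWS.dynPart σ η₁ T ℓ Φ τ a b θ N z + BDWS.initPart σ η₁ ℓ Φ a b θ N z`):
for every `N` the signed K2 functional is in `L¹(P_N)` (landed S1a `EABirthCore.inFrame_int` + `EABirthS1bNec.integrable_initPart`)
and for every `ε > 0` eventually `E_{P_N} K2f ≤ ε` (S1b at `(τ, φ := θ)`, `θ ≥ 0` by `temperature_pos`, plus the statics
`EABirthCore.inFrame_stat`: `E|B_N − B| → 0`).  Sources: BrezinaFeireisl2018 §3.2, Spohn1991 §3.3. -/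
def Sig.stub_meanEntropyForcing : Prop :=
  Sig.stub_meanEntropyDeficit → BoxDissipativeWeakStrong.HsEosLowDensity →
    ∃ ηc : ℝ, 0 < ηc ∧ ∀ η₁ : ℝ, 0 < η₁ → η₁ < ηc →
      ∀ (a₀ θ₀ : T3 → ℝ) (u₀ : T3 → V3), Continuous a₀ → Continuous θ₀ → Continuous u₀ →
        (∀ x, 0 < a₀ x) → (∀ x, 0 < θ₀ x) →
        ∃ σ₀ : ℝ, 0 < σ₀ ∧ ∀ σ : ℝ, 0 < σ → σ < σ₀ →
          ∀ (T : ℝ) (ρ θ : ℝ → T3 → ℝ) (u : ℝ → T3 → V3), IsHardSphereEulerSolution σ T ρ u θ →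
            (∀ t ∈ Ico 0 T, ∀ x, ρ t x * σ ^ 3 ≤ η₁ / 2) →
            ∀ Φ : (N : ℕ) → HardSphereFlow (Literature.Analysis.FluidPDE.Torus.geometry (Fin 3))
                (hsDiameter σ N) (N + 1),
              TendstoHydroFieldsAt (fun N => localGibbsLaw σ a₀ u₀ θ₀ N (Φ N)) Φ ρ u θ 0 →
                ∀ ℓ : ℕ → ℝ, IsKineticWindow ℓ → ∀ τ ∈ Ico 0 T, ∀ a b : ℝ, a < b →
                  (∀ N : ℕ, Integrable (fun z => ((∫ t in Ioc 0 τ, ∫ x,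
            ((boxState (ℓ N) ((Φ N).flow t z) x).1 *
                  max a (min ((cutEOS σ η₁).s (boxState (ℓ N) ((Φ N).flow t z) x).1
              (2 / 3 * ((boxState (ℓ N) ((Φ N).flow t z) x).2.2 /
                  (boxState (ℓ N) ((Φ N).flow t z) x).1 -
                ‖(boxState (ℓ N) ((Φ N).flow t z) x).2.1‖ ^ 2 /
                  (2 * (boxState (ℓ N) ((Φ N).flow t z) x).1 ^ 2)))) b) *
                Torus.timeDerivWithin (Ico 0 T) θ t x +
              max a (min ((cutEOS σ η₁).s (boxState (ℓ N) ((Φ N).flow t z) x).1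
              (2 / 3 * ((boxState (ℓ N) ((Φ N).flow t z) x).2.2 /
                  (boxState (ℓ N) ((Φ N).flow t z) x).1 -
                ‖(boxState (ℓ N) ((Φ N).flow t z) x).2.1‖ ^ 2 /
                  (2 * (boxState (ℓ N) ((Φ N).flow t z) x).1 ^ 2)))) b) *
                inner ℝ (boxState (ℓ N) ((Φ N).flow t z) x).2.1 (Torus.gradient (θ t) x))) -
          (∫ x, (boxState (ℓ N) ((Φ N).flow τ z) x).1 *
              max a (min ((cutEOS σ η₁).s (boxState (ℓ N) ((Φ N).flow τ z) x).1
              (2 / 3 * ((boxState (ℓ N) ((Φ N).flow τ z) x).2.2 /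
                  (boxState (ℓ N) ((Φ N).flow τ z) x).1 -
                ‖(boxState (ℓ N) ((Φ N).flow τ z) x).2.1‖ ^ 2 /
                  (2 * (boxState (ℓ N) ((Φ N).flow τ z) x).1 ^ 2)))) b) * θ τ x) +
          (∫ x, (boxState (ℓ N) ((Φ N).flow 0 z) x).1 *
              max a (min ((cutEOS σ η₁).s (boxState (ℓ N) ((Φ N).flow 0 z) x).1
              (2 / 3 * ((boxState (ℓ N) ((Φ N).flow 0 z) x).2.2 /
                  (boxState (ℓ N) ((Φ N).flow 0 z) x).1 -
                ‖(boxState (ℓ N) ((Φ N).flow 0 z) x).2.1‖ ^ 2 /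
                  (2 * (boxState (ℓ N) ((Φ N).flow 0 z) x).1 ^ 2)))) b) * θ 0 x)))
                    (localGibbsLaw σ a₀ u₀ θ₀ N (Φ N))) ∧
                  ∀ ε : ℝ, 0 < ε → ∀ᶠ N : ℕ in atTop,
                    (∫ z, ((∫ t in Ioc 0 τ, ∫ x,
            ((boxState (ℓ N) ((Φ N).flow t z) x).1 *
                  max a (min ((cutEOS σ η₁).s (boxState (ℓ N) ((Φ N).flow t z) x).1
              (2 / 3 * ((boxState (ℓ N) ((Φ N).flow t z) x).2.2 /
                  (boxState (ℓ N) ((Φ N).flow t z) x).1 -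
                ‖(boxState (ℓ N) ((Φ N).flow t z) x).2.1‖ ^ 2 /
                  (2 * (boxState (ℓ N) ((Φ N).flow t z) x).1 ^ 2)))) b) *
                Torus.timeDerivWithin (Ico 0 T) θ t x +
              max a (min ((cutEOS σ η₁).s (boxState (ℓ N) ((Φ N).flow t z) x).1
              (2 / 3 * ((boxState (ℓ N) ((Φ N).flow t z) x).2.2 /
                  (boxState (ℓ N) ((Φ N).flow t z) x).1 -
                ‖(boxState (ℓ N) ((Φ N).flow t z) x).2.1‖ ^ 2 /
                  (2 * (boxState (ℓ N) ((Φ N).flow t z) x).1 ^ 2)))) b) *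
                inner ℝ (boxState (ℓ N) ((Φ N).flow t z) x).2.1 (Torus.gradient (θ t) x))) -
          (∫ x, (boxState (ℓ N) ((Φ N).flow τ z) x).1 *
              max a (min ((cutEOS σ η₁).s (boxState (ℓ N) ((Φ N).flow τ z) x).1
              (2 / 3 * ((boxState (ℓ N) ((Φ N).flow τ z) x).2.2 /
                  (boxState (ℓ N) ((Φ N).flow τ z) x).1 -
                ‖(boxState (ℓ N) ((Φ N).flow τ z) x).2.1‖ ^ 2 /
                  (2 * (boxState (ℓ N) ((Φ N).flow τ z) x).1 ^ 2)))) b) * θ τ x) +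
          (∫ x, (boxState (ℓ N) ((Φ N).flow 0 z) x).1 *
              max a (min ((cutEOS σ η₁).s (boxState (ℓ N) ((Φ N).flow 0 z) x).1
              (2 / 3 * ((boxState (ℓ N) ((Φ N).flow 0 z) x).2.2 /
                  (boxState (ℓ N) ((Φ N).flow 0 z) x).1 -
                ‖(boxState (ℓ N) ((Φ N).flow 0 z) x).2.1‖ ^ 2 /
                  (2 * (boxState (ℓ N) ((Φ N).flow 0 z) x).1 ^ 2)))) b) * θ 0 x))
                      ∂(localGibbsLaw σ a₀ u₀ θ₀ N (Φ N))) ≤ ε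

end RESVocabulary

/-! ## §2 An abstract one-sided squeeze on probability spaces -/

/-- **Mean bound for a sum from a mean bound with a deterministic proxy.** On probability spaces `(Ω_N, P_N)`: if `A_N`,
`B_N` are integrable, `E|B_N − c| → 0` (outer integrals `∫⁻ ofReal`) and for every `ε > 0` eventually `E[A_N] + c ≤ ε`,
then for every `ε > 0` eventually `E[A_N + B_N] ≤ ε` (`E[A + B] = (E A + c) + E[B − c] ≤ (E A + c) + E|B − c|`). -/
theorem eventually_integral_add_le {Ω : ℕ → Type*} [∀ N, MeasurableSpace (Ω N)]
    (P : ∀ N, Measure (Ω N)) [hP : ∀ N, IsProbabilityMeasure (P N)] (A B : ∀ N, Ω N → ℝ) (c : ℝ)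
    (hA : ∀ N, Integrable (A N) (P N)) (hB : ∀ N, Integrable (B N) (P N))
    (h0 : Tendsto (fun N => ∫⁻ z, ENNReal.ofReal |B N z - c| ∂P N) atTop (𝓝 0))
    (h1 : ∀ ε : ℝ, 0 < ε → ∀ᶠ N in atTop, (∫ z, A N z ∂P N) + c ≤ ε) :
    ∀ ε : ℝ, 0 < ε → ∀ᶠ N in atTop, (∫ z, (A N z + B N z) ∂P N) ≤ ε := by
  intro ε hε
  have h0' : Tendsto (fun N => (∫⁻ z, ENNReal.ofReal |B N z - c| ∂P N).toReal) atTop (𝓝 0) := by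
    have := (ENNReal.tendsto_toReal ENNReal.zero_ne_top).comp h0
    simpa only [Function.comp_def, ENNReal.toReal_zero] using this
  filter_upwards [(tendsto_order.1 h0').2 (ε / 2) (half_pos hε), h1 (ε / 2) (half_pos hε)] with N hN0 hN1
  have hBc : Integrable (fun z => B N z - c) (P N) := (hB N).sub (integrable_const c)
  -- `E[A + B] = (E A + c) + E[B − c]`
  have hsplit : (∫ z, (A N z + B N z) ∂P N) = ((∫ z, A N z ∂P N) + c) + ∫ z, (B N z - c) ∂P N := by
    rw [integral_add (hA N) (hB N), integral_sub (hB N) (integrable_const c), integral_const, smul_eq_mul,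
      probReal_univ, one_mul]
    ring
  -- `E[B − c] ≤ E|B − c|`
  have h3 : (∫ z, (B N z - c) ∂P N) ≤ (∫⁻ z, ENNReal.ofReal |B N z - c| ∂P N).toReal := by
    calc (∫ z, (B N z - c) ∂P N) ≤ ∫ z, |B N z - c| ∂P N := integral_mono hBc hBc.abs fun z => le_abs_self _
      _ = (∫⁻ z, ENNReal.ofReal |B N z - c| ∂P N).toReal :=
          integral_eq_lintegral_of_nonneg_ae (Eventually.of_forall fun z => abs_nonneg _)
            hBc.abs.aestronglyMeasurable
  linarith

/-! ## §3 The mean entropy forcing in the crux's frame -/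

section Frame

open Summit.AtomisticToContinuum.HydrodynamicLimit.Theorems.BDWS

/-- The MEAN ENTROPY FORCING conclusion: for every `N` the signed functional `A_N + B_N` is in `L¹(P_N)`, and for every
`ε > 0` eventually `E_{P_N}[A_N + B_N] ≤ ε`. -/
def Cmef : Conclusion := fun σ η₁ a₀ θ₀ u₀ T _ρ _θ _u Φ ℓ τ a b φ =>
  (∀ N : ℕ, Integrable (fun z => dynPart σ η₁ T ℓ Φ τ a b φ N z + initPart σ η₁ ℓ Φ a b φ N z)
      (localGibbsLaw σ a₀ u₀ θ₀ N (Φ N))) ∧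
    ∀ ε : ℝ, 0 < ε → ∀ᶠ N : ℕ in atTop,
      (∫ z, (dynPart σ η₁ T ℓ Φ τ a b φ N z + initPart σ η₁ ℓ Φ a b φ N z) ∂(localGibbsLaw σ a₀ u₀ θ₀ N (Φ N))) ≤ ε

/-- **S1b ⇒ mean entropy forcing, in the frame** (with the landed S1a `EABirthCore.inFrame_int` and S0
`EABirthCore.inFrame_stat`; thresholds `η₀` of the EOS fact, for the integrability of `B_N`, and `σ < 1/2`, for `P_N` to be
a probability measure). -/
theorem inFrame_mef (hdef : InFrame Cdef) : InFrame Cmef := by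
  obtain ⟨η₀, hη₀, F, hFan, hFeq, -⟩ := BoxDissipativeWeakStrong.HsEosLowDensity_holds
  have hcont : ContinuousOn hsExcessFreeEnergy (Ico 0 η₀) := RES.sx_continuousOn_hsExcess hFan hFeq hη₀
  refine InFrame.mono₃ (C₁ := Cint) (C₂ := Cstat) (C₃ := Cdef) hη₀ one_half_pos ?_
    EABirthCore.inFrame_int EABirthCore.inFrame_stat hdef
  intro σ η₁ a₀ θ₀ u₀ T ρ θ u Φ ℓ τ a b φ hη₁ hs ha hθ hu ha0 hθ0 hσ ss _ _ _ hℓ _ _ hτ hab hφ _ c₁ c₂ c₃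
  haveI hP : ∀ N, IsProbabilityMeasure (localGibbsLaw σ a₀ u₀ θ₀ N (Φ N)) := fun N =>
    isProbabilityMeasure_localGibbsLaw ha hθ hu ha0 hθ0 ss.le N (Φ N)
  have hT : 0 < T := lt_of_le_of_lt hτ.1 hτ.2
  have hB : ∀ N, Integrable (initPart σ η₁ ℓ Φ a b φ N) (localGibbsLaw σ a₀ u₀ θ₀ N (Φ N)) := fun N =>
    EABirthS1bNec.integrable_initPart hcont hσ.le hη₁.le hs Φ (hℓ N).1 hT hab.le hφ _
  exact ⟨fun N => (c₁ N).add (hB N),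
    eventually_integral_add_le (fun N => localGibbsLaw σ a₀ u₀ θ₀ N (Φ N))
      (fun N z => dynPart σ η₁ T ℓ Φ τ a b φ N z) (fun N z => initPart σ η₁ ℓ Φ a b φ N z)
      (initLimit σ η₁ ρ θ a b φ) c₁ hB c₂ c₃⟩

end Frame

/-! ## §4 The stub -/

/-- **Registered stub `stub_meanEntropyForcing`** (C3b; crux stmt-AtomisticToContinuum-9903, line `mean_via_weak_strong`):
S1b together with the landed statics S0 and integrability S1a gives, at `φ := θ` (the strong temperature: smooth on
`[0,T) × 𝕋³`, positive), the mean entropy forcing of the signed relative-energy Grönwall — `K2f_N(τ) ∈ L¹(P_N)` for every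
`N` and `∫ K2f_N(τ) dP_N ≤ ε` eventually; the RES integrand is definitionally `dynPart … θ N z + initPart … θ N z`. -/
theorem stub_meanEntropyForcing : Sig.stub_meanEntropyForcing := by
  intro hS1b hEos
  have hdef : InFrame Cdef := hS1b
  obtain ⟨ηc, hηc, H⟩ := inFrame_mef hdef hEos
  refine ⟨ηc, hηc, fun η₁ hη₁ hη₁c a₀ θ₀ u₀ ha hθ hu ha0 hθ0 => ?_⟩
  obtain ⟨σ₀, hσ₀, G⟩ := H η₁ hη₁ hη₁c a₀ θ₀ u₀ ha hθ hu ha0 hθ0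
  refine ⟨σ₀, hσ₀, fun σ hσ hσlt T ρ θ u hsol hguard Φ h0 ℓ hℓ τ hτ a b hab => ?_⟩
  exact G σ hσ hσlt T ρ θ u hsol hguard Φ h0 ℓ hℓ.1 hℓ.2.1 hℓ.2.2 τ hτ a b hab θ hsol.smooth_temperature
    (fun t ht x => (hsol.temperature_pos t ⟨ht.1, ht.2.trans_lt hτ.2⟩ x).le)

end Summit.AtomisticToContinuum.HydrodynamicLimit.Theorems.EAMeanWSb

end
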